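import Mathlib
import Literature.NumberTheory.GaloisRepresentations.FramedRepTwist
import Literature.NumberTheory.Automorphic.ReciprocityGLnRestrictionProofs
import Literature.NumberTheory.Automorphic.ReciprocityGLnDescentProofs
import Literature.NumberTheory.Automorphic.QuadraticCharacterTwist
import Literature.NumberTheory.Automorphic.SatakeParamNeZeroProofs
import Literature.NumberTheory.Automorphic.ChebotarevArtinRepHolds
import HarnessLib

/-!
# Crux `MuOrdinaryFamilyRT` (stmt-Langlands-13757), line `char-zero-dominance`: Galois-side
# lemmas for stub 5 (`stub_quadraticDescent`) — the index-two Clifford dichotomy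

Registered sub-goal of the checked skeleton `Cruxes/MuOrdinaryFamilyRT/Lines/char-zero-dominance.lean`
(crux `Summit.Langlands.Langlands.Theses.PicardMuOrdinary.MuOrdinaryFamilyRT`), feeding the
conditional reduction of STUB 5 (quadratic descent `F' → K`) in the sibling file
`PicardMuOrdinaryMuOrdinaryFamilyRTQuadraticDescent.lean`.  Everything here is PROVED (no named
fact).  For a quadratic extension `E/L` of number fields, `H = Gal(L̄/E) ≤ Γ_L` (index `2`):
* `exists_quadChar` — the quadratic character `χ_{E/L} : Γ_L →ₜ* Aˣ` (`1` on `H`, `-1` off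
  `H`) in a topological field `A`, `2 ≠ 0` (the tree's `quadraticArtinChar` is `A = ℂ`);
* `exists_eq_algebraMap_of_forall_mul_eq` — Schur's lemma, matrix form (Mathlib
  `Representation.IsIrreducible.algebraMap_intertwiningMap_bijective_of_isAlgClosed`);
* `eq_conj_or_eq_conj_twist` — **the index-two Clifford dichotomy** (the registered theorem):
  `r|_{Γ_E} = P ρ|_{Γ_E} P⁻¹` with `ρ|_{Γ_E}` irreducible (`A` algebraically closed, `n ≥ 1`)
  forces `ρ = P⁻¹ r P` or `ρ = P⁻¹ (r ⊗ χ_{E/L}) P` (Clifford 1937; Curtis–Reiner §51);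
* `isGaloisStableSatakeAE_of_isGaloisCompatibleAt` — an automorphic `P` on `GL_n(𝔸_E)`
  compatible a.e. with a RESTRICTED `ρ|_{Γ_E}` has `Gal(E/L)`-stable Satake data;
* `not_conj_of_twist_quadraticSign` — for `n` odd, `P` and `P ⊗ η_{E/L}` cannot have conjugate
  compatible Galois representations (an inert good prime would give `-t = t`).

References: A. H. Clifford, Ann. of Math. 38 (1937), Thm. 1; C. W. Curtis, I. Reiner,
*Representation Theory of Finite Groups and Associative Algebras* (1962), §51; J.-P. Serre,
*Abelian ℓ-adic representations* (1968), Ch. I §2.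
-/

-- `Summit.Langlands.Langlands.…` (summit = sub-problem name, D-0017 layout) trips `dupNamespace` on every decl.
set_option linter.dupNamespace false

namespace Summit.Langlands.Langlands.Cruxes.MuOrdinaryFamilyRT.CharZeroDominance

open scoped NumberField Polynomial Matrix Classical MatrixGroups
open Field IsDedekindDomain Polynomial Filter
open Literature.NumberTheory.GaloisRepresentations Literature.NumberTheory.Automorphic

noncomputable section

/-! ## Schur's lemma, matrix form -/

section Schur

variable {G : Type*} [Group G] [TopologicalSpace G] {A : Type*} [Field A] [TopologicalSpace A]
  [IsAlgClosed A] {n : ℕ}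

/-- **Schur's lemma (matrix form).**  Over an algebraically closed field, a matrix commuting with
every `ρ(g)` for an irreducible framed representation `ρ` is a scalar (`v ↦ M v` is an
intertwining operator; Mathlib `algebraMap_intertwiningMap_bijective_of_isAlgClosed`). [folklore] -/
theorem exists_eq_algebraMap_of_forall_mul_eq (ρ : FramedRep G A n) (hρ : ρ.IsIrreducible)
    (M : Matrix (Fin n) (Fin n) A)
    (hM : ∀ g : G, M * ((ρ g : GL (Fin n) A) : Matrix (Fin n) (Fin n) A) =
      ((ρ g : GL (Fin n) A) : Matrix (Fin n) (Fin n) A) * M) :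
    ∃ c : A, M = algebraMap A (Matrix (Fin n) (Fin n) A) c := by
  haveI : ρ.toRepresentation.IsIrreducible := hρ
  have hf : ∀ (g : G) (v : Fin n → A),
      Matrix.toLin' M (ρ.toRepresentation g v) = ρ.toRepresentation g (Matrix.toLin' M v) := by
    intro g v
    simp only [FramedRep.toRepresentation_apply_apply, Matrix.toLin'_apply, Matrix.mulVec_mulVec,
      hM g]
  let f : ρ.toRepresentation.IntertwiningMap ρ.toRepresentation :=
    LinearMap.intertwiningMap_of_isIntertwiningMap ρ.toRepresentation ρ.toRepresentation
      (Matrix.toLin' M) hf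
  obtain ⟨c, hc⟩ :=
    (Representation.IsIrreducible.algebraMap_intertwiningMap_bijective_of_isAlgClosed
      (ρ := ρ.toRepresentation)).2 f
  refine ⟨c, Matrix.toLin'.injective (LinearMap.ext fun v => ?_)⟩
  have h1 : f v = c • v := by
    rw [← hc, Representation.IntertwiningMap.algebraMap_apply,
      Representation.IntertwiningMap.coe_smul, Pi.smul_apply,
      Representation.IntertwiningMap.coe_one, id]
  have h2 : f v = M *ᵥ v := rfl
  rw [Matrix.toLin'_apply, Matrix.toLin'_apply, ← h2, h1, Algebra.algebraMap_eq_smul_one,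
    Matrix.smul_mulVec, Matrix.one_mulVec]

end Schur

/-! ## The quadratic character with values in `Aˣ` and the index-two Clifford dichotomy -/

section Clifford

variable {L : Type} [Field L] [NumberField L] {E : Type} [Field E] [NumberField E] [Algebra L E]
  {A : Type*} [Field A] [TopologicalSpace A] [IsTopologicalRing A]

omit [IsTopologicalRing A] in
/-- Some element of `Γ_L` does not fix `E` (the image of `Γ_E → Γ_L` has index `2 ≠ 1`).
[folklore] -/
theorem exists_not_mem_range_absGaloisRestrict (h2 : Module.finrank L E = 2) :
    ∃ g : absoluteGaloisGroup L, g ∉ (absGaloisRestrict L E).range := by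
  by_contra! hall
  have hH2 := (isOpen_range_absGaloisRestrict_and_index_eq_two L E h2).2
  have htop : (absGaloisRestrict L E).range = ⊤ := eq_top_iff.mpr fun x _ => hall x
  rw [htop, Subgroup.index_top] at hH2
  exact absurd hH2 (by norm_num)

/-- **The quadratic character `χ_{E/L} : Γ_L → {±1} ⊂ Aˣ` exists** for a quadratic `E/L`:
`1` on the index-two open subgroup `Gal(L̄/E) = range (absGaloisRestrict L E)`, `-1` off it
(`signCharOfIndexTwo`; continuous as its kernel is open when `2 ≠ 0` in `A`; for `A = ℂ` this is
the tree's `quadraticArtinChar`).  No new definition is introduced: the two displayed properties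
determine `χ`.  Tate, Cassels–Fröhlich Ch. VII §3. [folklore] -/
theorem exists_quadChar [NeZero (2 : A)] (h2 : Module.finrank L E = 2) :
    ∃ χ : absoluteGaloisGroup L →ₜ* Aˣ, (∀ g ∈ (absGaloisRestrict L E).range, χ g = 1) ∧
      ∀ g ∉ (absGaloisRestrict L E).range, χ g = -1 := by
  obtain ⟨hopen, hH2⟩ := isOpen_range_absGaloisRestrict_and_index_eq_two L E h2
  refine ⟨⟨signCharOfIndexTwo (R := A) _ hH2, MonoidHom.continuous_of_isOpen_ker _ (by
      rw [ker_signCharOfIndexTwo]; exact hopen)⟩, fun g hg => ?_, fun g hg => ?_⟩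
  · exact signCharOfIndexTwo_apply_of_mem hH2 hg
  · exact signCharOfIndexTwo_apply_of_not_mem hH2 hg

omit [NumberField L] in
/-- `(ρ ⊗ χ) ⊗ χ = ρ` for a character `χ` with `χ² = 1` pointwise. [folklore] -/
theorem twist_twist_of_mul_self {n : ℕ} (ρ : FramedGaloisRep L A n)
    (χ : absoluteGaloisGroup L →ₜ* Aˣ) (hχ : ∀ g, χ g * χ g = 1) : (ρ.twist χ).twist χ = ρ := by
  have h1 : χ * χ = 1 := ContinuousMonoidHom.ext fun g => hχ g
  rw [FramedRep.twist_twist, h1, FramedRep.twist_one]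

omit [NumberField L] [NumberField E] [IsTopologicalRing A] in
/-- A character which is `±1` according to membership in `Gal(L̄/E)` has `χ² = 1`. [folklore] -/
theorem mul_self_eq_one_of_quadChar (χ : absoluteGaloisGroup L →ₜ* Aˣ)
    (hχ₁ : ∀ g ∈ (absGaloisRestrict L E).range, χ g = 1)
    (hχ₂ : ∀ g ∉ (absGaloisRestrict L E).range, χ g = -1) (g : absoluteGaloisGroup L) :
    χ g * χ g = 1 := by
  by_cases hg : g ∈ (absGaloisRestrict L E).range
  · rw [hχ₁ g hg, one_mul]
  · rw [hχ₂ g hg, neg_mul_neg, one_mul]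

/-- **The index-two Clifford dichotomy.**  `E/L` quadratic, `A` an algebraically closed
topological field, `n ≥ 1`, `ρ, r : Γ_L → GL_n(A)` with `r|_{Γ_E} = P ρ|_{Γ_E} P⁻¹` and `ρ|_{Γ_E}`
irreducible, `χ = χ_{E/L}` (`exists_quadChar`).  Then `ρ = P⁻¹ r P` or `ρ = P⁻¹ (r ⊗ χ) P`: with `r' = P⁻¹ r P = ρ` on
`H = Gal(L̄/E)` and `g₀ ∉ H`, `u = ρ(g₀) r'(g₀)⁻¹` centralises `ρ(H)` (`H` normal), so is a scalar
`c` (Schur) with `c² = 1` (`g₀² ∈ H`), and `ρ = u r'` off `H`.  Clifford 1937, Thm. 1;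
Curtis–Reiner 1962, (51.7). [folklore] -/
theorem eq_conj_or_eq_conj_twist [IsAlgClosed A] {n : ℕ} [NeZero n]
    (h2 : Module.finrank L E = 2) (ρ r : FramedGaloisRep L A n)
    (hirr : (ρ.restrictField E).IsIrreducible) (P : GL (Fin n) A)
    (hP : r.restrictField E = (ρ.restrictField E).conj P) (χ : absoluteGaloisGroup L →ₜ* Aˣ)
    (hχ₁ : ∀ g ∈ (absGaloisRestrict L E).range, χ g = 1)
    (hχ₂ : ∀ g ∉ (absGaloisRestrict L E).range, χ g = -1) :
    ρ = r.conj P⁻¹ ∨ ρ = (r.twist χ).conj P⁻¹ := by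
  set H : Subgroup (absoluteGaloisGroup L) := (absGaloisRestrict L E).range with hHdef
  have hH2 : H.index = 2 := (isOpen_range_absGaloisRestrict_and_index_eq_two L E h2).2
  haveI hHn : H.Normal := Subgroup.normal_of_index_eq_two hH2
  -- `r' = P⁻¹ r P` agrees with `ρ` on `H`
  let r' : FramedGaloisRep L A n := r.conj P⁻¹
  have hr' : ∀ g, r' g = P⁻¹ * r g * P := fun g => by
    change r.conj P⁻¹ g = _
    rw [FramedRep.conj_apply, inv_inv]
  have hagree : ∀ h ∈ H, r' h = ρ h := by
    rintro _ ⟨x, rfl⟩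
    have e := congrArg (fun σ : FramedGaloisRep E A n => σ x) hP
    simp only [FramedGaloisRep.restrictField_apply, FramedRep.conj_apply] at e
    change r' (absGaloisRestrict L E x) = ρ (absGaloisRestrict L E x)
    rw [hr', e]
    group
  obtain ⟨g₀, hg₀⟩ := exists_not_mem_range_absGaloisRestrict (L := L) (E := E) h2
  have hg₀inv : g₀⁻¹ ∉ H := fun h => hg₀ (inv_inv g₀ ▸ H.inv_mem h)
  -- `u = ρ(g₀) r'(g₀)⁻¹` commutes with `ρ(H)`
  set u : GL (Fin n) A := ρ g₀ * (r' g₀)⁻¹ with hu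
  have hcomm : ∀ h ∈ H, ρ h * u = u * ρ h := by
    intro h hh
    have hmem : g₀⁻¹ * h * g₀ ∈ H := by simpa using hHn.conj_mem h hh g₀⁻¹
    have e1 := hagree _ hmem
    rw [map_mul, map_mul, map_inv, map_mul, map_mul, map_inv, hagree h hh] at e1
    calc ρ h * u = ρ g₀ * ((ρ g₀)⁻¹ * ρ h * ρ g₀) * (r' g₀)⁻¹ := by rw [hu]; group
      _ = ρ g₀ * ((r' g₀)⁻¹ * ρ h * r' g₀) * (r' g₀)⁻¹ := by rw [e1]
      _ = u * ρ h := by rw [hu]; group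
  -- Schur: `u` is a scalar `c`
  obtain ⟨c, hc⟩ : ∃ c : A, (u : Matrix (Fin n) (Fin n) A) = algebraMap A _ c := by
    refine exists_eq_algebraMap_of_forall_mul_eq (ρ.restrictField E) hirr _ fun x => ?_
    have e := congrArg (fun g : GL (Fin n) A => (g : Matrix (Fin n) (Fin n) A))
      (hcomm (absGaloisRestrict L E x) ⟨x, rfl⟩).symm
    simpa only [Units.val_mul, FramedGaloisRep.restrictField_apply] using e
  haveI : Nonempty (Fin n) := ⟨⟨0, Nat.pos_of_ne_zero (NeZero.ne n)⟩⟩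
  have hinj : Function.Injective (algebraMap A (Matrix (Fin n) (Fin n) A)) :=
    (algebraMap A (Matrix (Fin n) (Fin n) A)).injective
  have hc0 : c ≠ 0 := by
    rintro rfl
    rw [map_zero] at hc
    exact u.ne_zero hc
  -- `c² = 1` from `g₀² ∈ H`
  have huu : u * u = 1 := by
    have e1 := hagree _ (Subgroup.mul_self_mem_of_index_two hH2 g₀)
    rw [map_mul, map_mul] at e1
    have e2 : ρ g₀ = u * r' g₀ := by rw [hu]; group
    have hu' : u = FramedRep.scalar A n (Units.mk0 c hc0) := Units.ext (by rw [hc]; rfl)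
    have e3 : r' g₀ * u = u * r' g₀ := by rw [hu']; exact (FramedRep.scalar_mul_comm _ _).symm
    have e4 : r' g₀ * r' g₀ = (u * u) * (r' g₀ * r' g₀) := by
      calc r' g₀ * r' g₀ = ρ g₀ * ρ g₀ := e1
        _ = u * (r' g₀ * u) * r' g₀ := by rw [e2]; group
        _ = (u * u) * (r' g₀ * r' g₀) := by rw [e3]; group
    exact (mul_eq_right.mp e4.symm)
  have hc2 : c * c = 1 := by
    apply hinj
    rw [map_mul, map_one, ← hc, ← Units.val_mul, huu, Units.val_one]
  -- `ρ = u · r'` off `H`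
  have hoff : ∀ g ∉ H, ρ g = u * r' g := by
    intro g hg
    have hmem : g₀⁻¹ * g ∈ H := (Subgroup.mul_mem_iff_of_index_two hH2).mpr (iff_of_false hg₀inv hg)
    calc ρ g = ρ g₀ * ρ (g₀⁻¹ * g) := by rw [← map_mul]; group
      _ = ρ g₀ * r' (g₀⁻¹ * g) := by rw [hagree _ hmem]
      _ = u * r' g := by rw [map_mul, map_inv, hu]; group
  rcases mul_self_eq_one_iff.mp hc2 with rfl | rfl
  · -- `c = 1`: `u = 1`, `ρ = r'`
    have hu1 : u = 1 := Units.ext (by rw [hc, map_one, Units.val_one])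
    refine Or.inl (ContinuousMonoidHom.ext fun g => ?_)
    by_cases hg : g ∈ H
    · exact (hagree g hg).symm
    · rw [hoff g hg, hu1, one_mul]
  · -- `c = -1`: `u = -1`, `ρ = r' ⊗ χ`
    have hu1 : u = FramedRep.scalar A n (-1) := Units.ext (by
      rw [hc, FramedRep.coe_scalar_apply, Units.val_neg, Units.val_one])
    refine Or.inr ?_
    rw [FramedRep.conj_twist]
    refine ContinuousMonoidHom.ext fun g => ?_
    change ρ g = FramedRep.twist r' χ g
    rw [FramedRep.twist_apply]
    by_cases hg : g ∈ H
    · rw [hχ₁ g hg, map_one, one_mul]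
      exact (hagree g hg).symm
    · rw [hχ₂ g hg, ← hu1]
      exact hoff g hg

omit [NumberField L] in
/-- `(P' (P ρ P⁻¹) P'⁻¹) = (P'P) ρ (P'P)⁻¹`. [folklore] -/
theorem conj_conj {n : ℕ} (ρ : FramedGaloisRep L A n) (P P' : GL (Fin n) A) :
    (ρ.conj P).conj P' = ρ.conj (P' * P) :=
  ContinuousMonoidHom.ext fun g => by simp only [FramedRep.conj_apply, mul_inv_rev, mul_assoc]

omit [NumberField L] in
/-- If `ρ ⊗ χ` and `ρ'' ⊗ χ` are conjugate (`χ² = 1`), so are `ρ` and `ρ''` (untwist by `χ`;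
`FramedRep.conj_twist`). [folklore] -/
theorem eq_conj_of_twist_conj_eq {n : ℕ} (χ : absoluteGaloisGroup L →ₜ* Aˣ)
    (hχ : ∀ g, χ g * χ g = 1) (ρ ρ'' : FramedGaloisRep L A n) (Q Q'' : GL (Fin n) A)
    (h : (ρ''.twist χ).conj Q'' = (ρ.twist χ).conj Q) : ρ'' = ρ.conj (Q''⁻¹ * Q) := by
  have e2 : ρ''.twist χ = (ρ.twist χ).conj (Q''⁻¹ * Q) := by
    have e1 := congrArg (FramedRep.conj Q''⁻¹) h
    rw [conj_conj, conj_conj, inv_mul_cancel] at e1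
    rw [← e1]
    exact (ContinuousMonoidHom.ext fun g => by
      simp only [FramedRep.conj_apply, one_mul, inv_one, mul_one])
  calc ρ'' = (ρ''.twist χ).twist χ := (twist_twist_of_mul_self ρ'' χ hχ).symm
    _ = ((ρ.twist χ).conj (Q''⁻¹ * Q)).twist χ := by rw [e2]
    _ = ((ρ.twist χ).twist χ).conj (Q''⁻¹ * Q) := (FramedRep.conj_twist _ _ _).symm
    _ = ρ.conj (Q''⁻¹ * Q) := by rw [twist_twist_of_mul_self ρ χ hχ]

/-- **The index-two Clifford dichotomy over `ℚ̄₃`** (registered sub-goal form of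
`eq_conj_or_eq_conj_twist`, as consumed by `stub_quadraticDescent_of`). [folklore] -/
theorem clifford_index_two : ∀ {L : Type} [Field L] [NumberField L] {E : Type} [Field E] [NumberField E] [Algebra L E] {n : ℕ} [NeZero n] (h2 : Module.finrank L E = 2) (ρ r : FramedGaloisRep L (PadicAlgCl 3) n), (ρ.restrictField E).IsIrreducible → ∀ P : GL (Fin n) (PadicAlgCl 3), r.restrictField E = (ρ.restrictField E).conj P → ∀ χ : absoluteGaloisGroup L →ₜ* (PadicAlgCl 3)ˣ, (∀ g ∈ (absGaloisRestrict L E).range, χ g = 1) → (∀ g ∉ (absGaloisRestrict L E).range, χ g = -1) → ρ = r.conj P⁻¹ ∨ ρ = (r.twist χ).conj P⁻¹ :=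
  fun h2 ρ r hirr P hP χ hχ₁ hχ₂ => eq_conj_or_eq_conj_twist h2 ρ r hirr P hP χ hχ₁ hχ₂

end Clifford

/-! ## Automorphic consequences: stable Satake data; `P` versus `P ⊗ η` -/

section Automorphic

variable {L : Type} [Field L] [NumberField L] {E : Type} [Field E] [NumberField E] [Algebra L E]
  {n : ℕ} {ℓ : ℕ} [Fact ℓ.Prime]

/-- `α ↦ arithFrobPolyOfSatake ι q m α` is injective for `q ≠ 0` (roots `ι⁻¹((√q^{m-1} a)⁻¹)`,
`roots_arithFrobPolyOfSatake`). [folklore] -/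
theorem arithFrobPolyOfSatake_injective (ι : PadicAlgCl ℓ ≃+* ℂ) {q : ℕ} (hq : q ≠ 0) (m : ℕ)
    {α β : Multiset ℂ} (h : arithFrobPolyOfSatake ι q m α = arithFrobPolyOfSatake ι q m β) :
    α = β := by
  have hr := congrArg Polynomial.roots h
  rw [roots_arithFrobPolyOfSatake, roots_arithFrobPolyOfSatake] at hr
  refine Multiset.map_injective ?_ hr
  intro a b hab
  have hq' : (0 : ℝ) < Real.sqrt q := Real.sqrt_pos.mpr (by exact_mod_cast Nat.pos_of_ne_zero hq)
  have hc : ((Real.sqrt q : ℝ) : ℂ) ^ (m - 1) ≠ 0 := pow_ne_zero _ (by exact_mod_cast hq'.ne')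
  exact mul_left_cancel₀ hc (inv_inj.mp (ι.symm.injective hab))

/-- **Compatibility with `ρ|_{Γ_E}` forces `Gal(E/L)`-stable Satake data.**  `E/L` Galois,
`ρ : Γ_L → GL_n(ℚ̄_ℓ)`, `P` automorphic on `GL_n(𝔸_E)`, unramified and compatible with `ρ|_{Γ_E}`
at almost every `w`.  Then `IsGaloisStableSatakeAE L P`: at a good `w ∣ v` (all `w' ∣ v` good,
`v` unramified in `E`) `ρ` is unramified at `v` (`isUnramifiedAt_of_restrictField`) with Frobenius
polynomial `∏ (X - b)`, so `ρ|_{Γ_E}` has `∏ (X - b^f)` at every `w' ∣ v`, `f` the common residue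
degree (`hasFrobCharpolyAt_restrictField`), and the `t_{P,w'}` coincide
(`arithFrobPolyOfSatake_injective`) — the unramified shadow of `r^τ ≅ r ⇒ P^τ ≅ P`. [folklore] -/
theorem isGaloisStableSatakeAE_of_isGaloisCompatibleAt [IsGalois L E]
    {hE : isCompact_glFiniteIntegralLevel n E} (P : AutomorphicRepData (AutomorphyDatum.gl n E hE))
    (ι : PadicAlgCl ℓ ≃+* ℂ) (ρ : FramedGaloisRep L (PadicAlgCl ℓ) n)
    (h : ∀ᶠ w : HeightOneSpectrum (𝓞 E) in cofinite,
      P.IsUnramifiedAt w ∧ IsGaloisCompatibleAt P ι (ρ.restrictField E) w) :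
    IsGaloisStableSatakeAE L P := by
  have hunr : ∀ᶠ v : HeightOneSpectrum (𝓞 L) in cofinite,
      Algebra.IsUnramifiedIn (𝓞 E) v.asIdeal := by
    rw [eventually_cofinite]
    exact finite_setOf_not_isUnramifiedIn L E
  have h1 := eventually_under (E := E) ((eventually_forall_under_eq (F := L) h).and hunr)
  refine h1.mono fun w hw w' hw' α hα => ?_
  obtain ⟨hall, hvE⟩ := hw (w.under (𝓞 L)) rfl
  set v : HeightOneSpectrum (𝓞 L) := w.under (𝓞 L) with hvdef
  have hwv : w.asIdeal.under (𝓞 L) = v.asIdeal := rfl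
  -- `ρ` is unramified at `v`
  have hρv : ρ.IsUnramifiedAt v :=
    ρ.isUnramifiedAt_of_restrictField (ramificationIdxIn_eq_one_of_isUnramifiedIn hvE)
      fun w'' hw'' => by
        obtain ⟨⟨β, hβ⟩, hc⟩ := hall w'' hw''
        exact (hc β hβ).1
  -- its Frobenius polynomial at `v`, split into linear factors
  obtain ⟨𝔓, h𝔓⟩ := HeightOneSpectrum.primesAbove_nonempty v
  obtain ⟨φ, hφ⟩ := HeightOneSpectrum.exists_isArithFrobAt_of_mem_primesAbove_holds h𝔓
  have hQ : ρ.HasFrobCharpolyAt v (ρ.toGaloisRep.frobCharpoly v) :=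
    (FramedGaloisRep.hasFrobCharpolyAt_toGaloisRep_iff v _ ρ).mp (GaloisRep.hasFrobCharpolyAt_frobCharpoly_holds
      ((FramedGaloisRep.isUnramifiedAt_toGaloisRep_iff v ρ).mpr hρv))
  set Q := ρ.toGaloisRep.frobCharpoly v with hQdef
  have hQφ : FramedRep.charpoly ρ φ = Q := hQ 𝔓 h𝔓 φ hφ
  have hsplit : Q = (Q.roots.map fun b => X - C b).prod := by
    rw [← hQφ]
    exact (prod_multiset_X_sub_C_of_monic_of_roots_card_eq (Matrix.charpoly_monic _)
      (IsAlgClosed.card_roots_eq_natDegree)).symm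
  have hQ' : ρ.HasFrobCharpolyAt v ((Q.roots.map fun b => X - C b).prod) := hsplit ▸ hQ
  -- the predicted polynomial at every `w'' ∣ v` is `∏ (X - b^f)`
  have key : ∀ w'' : HeightOneSpectrum (𝓞 E), w''.asIdeal.under (𝓞 L) = v.asIdeal →
      ∀ β : Multiset ℂ, P.HasSatakeParamAt w'' β →
        arithFrobPolyOfSatake ι (v.residueCard ^ v.asIdeal.inertiaDegIn (𝓞 E)) n β =
          (Q.roots.map fun b => X - C (b ^ v.asIdeal.inertiaDegIn (𝓞 E))).prod := by
    intro w'' hw'' β hβ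
    obtain ⟨-, hc⟩ := hall w'' hw''
    have e1 := (hc β hβ).2
    have e2 := ρ.hasFrobCharpolyAt_restrictField hw'' hρv hQ'
    rw [residueCard_eq_residueCard_pow_inertiaDeg hw'', inertiaDeg_eq_inertiaDegIn hw''] at e1
    rw [inertiaDeg_eq_inertiaDegIn hw''] at e2
    exact GaloisRep.HasFrobCharpolyAt.unique_holds
      ((FramedGaloisRep.hasFrobCharpolyAt_toGaloisRep_iff _ _ _).mpr e1)
      ((FramedGaloisRep.hasFrobCharpolyAt_toGaloisRep_iff _ _ _).mpr e2)
  obtain ⟨⟨αw, hαw⟩, -⟩ := hall w hwv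
  obtain ⟨⟨αw', hαw'⟩, -⟩ := hall w' (hw'.trans hwv)
  have e := (key w hwv αw hαw).trans (key w' (hw'.trans hwv) αw' hαw').symm
  have hq : v.residueCard ^ v.asIdeal.inertiaDegIn (𝓞 E) ≠ 0 :=
    pow_ne_zero _ (Nat.one_lt_iff_ne_zero_and_ne_one.mp (HeightOneSpectrum.one_lt_residueCard v)).1
  have heq : αw = αw' := arithFrobPolyOfSatake_injective ι hq n e
  obtain rfl : α = αw := P.hasSatakeParamAt_unique_holds hα hαw
  rw [heq]
  exact hαw'

/-- **Infinitely many places are inert in a quadratic extension**: `ε_{E/L}(v) = -1` frequently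
(Chebotarev, `infinite_setOf_frob_eq_and_quadraticSign_eq_neg_one`, `chebotarev_artinRep_holds`).
[folklore] -/
theorem frequently_quadraticSign_eq_neg_one (h2 : Module.finrank L E = 2) :
    ∃ᶠ v : HeightOneSpectrum (𝓞 L) in cofinite, quadraticSign E v = -1 := by
  obtain ⟨g₀, hg₀⟩ := exists_not_mem_range_absGaloisRestrict (L := L) (E := E) h2
  have hinf := infinite_setOf_frob_eq_and_quadraticSign_eq_neg_one E chebotarev_artinRep_holds
    (1 : FramedArtinRep L 2) h2 hg₀
  rw [Set.infinite_iff_frequently_cofinite] at hinf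
  exact hinf.mono fun v hv => hv.2.1

/-- **`P` and `P ⊗ η_{E/L}` have no conjugate Galois representations** (`n` odd): if
`t_{P'',v} = ε_{E/L}(v) t_{P,v}` a.e. and `r, r''` are compatible a.e. with `P, P''`, then
`r'' ≠ Q r Q⁻¹` — else at an inert good place (`frequently_quadraticSign_eq_neg_one`)
`t_{P,v} = -t_{P,v}` (`arithFrobPolyOfSatake_injective`), impossible for `n` odd non-zero numbers
(`hasSatakeParamAt_ne_zero_holds`: the product would vanish). [folklore] -/
theorem not_conj_of_twist_quadraticSign (hn : Odd n) (h2 : Module.finrank L E = 2)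
    {hL : isCompact_glFiniteIntegralLevel n L}
    (P P'' : AutomorphicRepData (AutomorphyDatum.gl n L hL)) (ι : PadicAlgCl ℓ ≃+* ℂ)
    (r r'' : FramedGaloisRep L (PadicAlgCl ℓ) n) (Q : GL (Fin n) (PadicAlgCl ℓ))
    (htw : ∀ᶠ v : HeightOneSpectrum (𝓞 L) in cofinite, ∀ α : Multiset ℂ,
      P.HasSatakeParamAt v α → P''.HasSatakeParamAt v (α.map (quadraticSign E v * ·)))
    (hc : ∀ᶠ v : HeightOneSpectrum (𝓞 L) in cofinite, IsGaloisCompatibleAt P ι r v)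
    (hc'' : ∀ᶠ v : HeightOneSpectrum (𝓞 L) in cofinite, IsGaloisCompatibleAt P'' ι r'' v)
    (hconj : r'' = r.conj Q) : False := by
  have hPunr : ∀ᶠ v : HeightOneSpectrum (𝓞 L) in cofinite, P.IsUnramifiedAt v :=
    P.hasSatakeParamAt_cofinite_holds
  obtain ⟨v, hεv, ⟨β, hβ⟩, htwv, hcv, hc''v⟩ :=
    ((frequently_quadraticSign_eq_neg_one (L := L) (E := E) h2).and_eventually
      (hPunr.and (htw.and (hc.and hc'')))).exists
  have hβ'' := htwv β hβ
  rw [hεv] at hβ''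
  obtain ⟨hur, h1⟩ := hcv β hβ
  obtain ⟨-, h2'⟩ := hc''v _ hβ''
  rw [hconj, FramedGaloisRep.hasFrobCharpolyAt_conj_iff] at h2'
  have e := GaloisRep.HasFrobCharpolyAt.unique_holds
    ((FramedGaloisRep.hasFrobCharpolyAt_toGaloisRep_iff _ _ _).mpr h1)
    ((FramedGaloisRep.hasFrobCharpolyAt_toGaloisRep_iff _ _ _).mpr h2')
  have hq : v.residueCard ≠ 0 :=
    (Nat.one_lt_iff_ne_zero_and_ne_one.mp (HeightOneSpectrum.one_lt_residueCard v)).1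
  have heq := arithFrobPolyOfSatake_injective ι hq n e
  have hprod := congrArg Multiset.prod heq
  rw [Multiset.prod_map_mul, Multiset.map_const', Multiset.prod_replicate, Multiset.map_id',
    hβ.card_eq, hn.neg_one_pow, neg_one_mul] at hprod
  have h3 : (2 : ℂ) * β.prod = 0 := by linear_combination hprod
  have h0 : β.prod = 0 := (mul_eq_zero.mp h3).resolve_left two_ne_zero
  exact hasSatakeParamAt_ne_zero_holds hβ 0 (Multiset.prod_eq_zero_iff.mp h0) rfl

end Automorphic

end

end Summit.Langlands.Langlands.Cruxes.MuOrdinaryFamilyRT.CharZeroDominance
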